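import Literature.RepresentationTheory.CharacterIsotypicSubspace
import Mathlib.LinearAlgebra.Eigenspace.Pi
import Mathlib.LinearAlgebra.Eigenspace.Semisimple
import Mathlib.LinearAlgebra.Eigenspace.Triangularizable
import Mathlib.LinearAlgebra.Semisimple
import Mathlib.FieldTheory.IsAlgClosed.Basic
import Mathlib.FieldTheory.Separable
import Mathlib.GroupTheory.Index
import Mathlib.GroupTheory.OrderOfElement
import Mathlib.Algebra.DirectSum.Module
import HarnessLib

/-!
# Weight decomposition of a representation of a commutative group with finite-index stabilisers

For a field `k`, a commutative group `Z` and a representation `ρ : Representation k Z V`, write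
`wt ρ ψ := weightSpace ρ id (fun z => ((ψ z : kˣ) : k))` (the joint eigenspace of the tree's
`CharacterIsotypicSubspace.lean`) for a character `ψ : Z →* kˣ`.  KERNEL ONLY: theorems and one `def` with body
(`weightProj`); no named fact.

* `iSupIndep_weightSpace` — the weight spaces of distinct characters are independent (any field);
* `eq_one_of_mem_weightSpace` — a character occurring on a non-zero vector fixed by `n` is trivial at `n`;
* `mem_iSup_weightSpace_of_fixed`, `iSup_weightSpace_eq_top` — for `k` algebraically closed of characteristic `0`,
  if every vector is fixed by a finite-index subgroup then `⨆ ψ, wt ρ ψ = ⊤`.  Engine: the `k`-span of the orbit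
  `ρ(Z) v` is finite-dimensional (the orbit factors through the finite quotient `Z ⧸ N`) and killed by `N`, so on it
  every `ρ z` satisfies `X ^ [Z : N] − 1`, squarefree in characteristic `0`, hence is semisimple
  (Mathlib `Module.End.isSemisimple_of_squarefree_aeval_eq_zero`); its maximal generalised eigenspaces are
  eigenspaces and the simultaneous eigenspaces of the commuting family span
  (Mathlib `Module.End.iSup_iInf_maxGenEigenspace_eq_top_of_iSup_maxGenEigenspace_eq_top_of_commute`); a non-zero
  simultaneous eigenvector defines a character `Z →* kˣ`;
* `isInternal_weightSpace` — hence `V = ⨁ ψ, wt ρ ψ` (`DirectSum.IsInternal`);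
* `weightProj` — the projections of this decomposition, with `weightProj_apply_mem`, `weightProj_eq_self_of_mem`,
  `weightProj_eq_zero_of_mem_ne`, `weightProj_weightProj`, `exists_finset_sum_weightProj` (finite support and
  reconstruction) and `weightProj_comm`: every endomorphism commuting with `ρ(Z)` commutes with the projections.

This is the linear algebra behind the decomposition of the first cohomology of the unitary Shimura curve tower under
the centre `E¹(𝔸_f)` of `U(J⋆)(𝔸_f)` in the proof of [Liu2021, Thm. 4.15] (see-saw step, l. 2199–2212), cf.
[GelbartRogawski1991, §3.1].

## References
* [Liu2021] Y. Liu, *Fourier–Jacobi cycles and arithmetic relative trace formula*, Camb. J. Math. 9 (2021): proof of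
  Thm. 4.15 (l. 2199–2212).
* [GelbartRogawski1991] S. Gelbart, J. Rogawski, *L-functions and Fourier–Jacobi coefficients for the unitary group
  U(3)*, Invent. Math. 105 (1991), §3.1, pp. 454–457.
-/

set_option autoImplicit false

noncomputable section

open scoped BigOperators DirectSum

namespace Literature.RepresentationTheory

variable {k : Type*} [Field k] {Z : Type*} [CommGroup Z] {V : Type*} [AddCommGroup V] [Module k V]
  (ρ : Representation k Z V)

/-- the weight space `{v | ∀ z, ρ z v = ψ z • v}` of a character `ψ : Z →* kˣ` (abbreviation for the tree's
`weightSpace ρ id (ψ ·)`). [cite: GelbartRogawski1991, §3.1 p. 454] -/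
abbrev wt (ψ : Z →* kˣ) : Submodule k V := weightSpace ρ id (fun z => ((ψ z : kˣ) : k))

/-! ## Independence of the weight spaces; stabilisers -/

/-- the weight space lies in the simultaneous maximal generalised eigenspace of the family `ρ z`, `z : Z`, for the
eigenvalue function `z ↦ ψ z`. [cite: GelbartRogawski1991, §3.1 p. 454] -/
theorem wt_le_iInf_maxGenEigenspace (ψ : Z →* kˣ) :
    wt ρ ψ ≤ ⨅ z, Module.End.maxGenEigenspace (ρ z) (((ψ z : kˣ) : k)) := by
  refine le_iInf fun z => ?_
  exact (iInf_le _ z).trans Module.End.eigenspace_le_maxGenEigenspace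

/-- the weight spaces of distinct characters are INDEPENDENT (`iSupIndep`), over any field.
[cite: GelbartRogawski1991, §3.1 p. 454] -/
theorem iSupIndep_weightSpace : iSupIndep fun ψ : Z →* kˣ => wt ρ ψ := by
  -- Mathlib: the simultaneous maximal generalised eigenspaces of a commuting family are independent
  have hind : iSupIndep fun χ : Z → k => ⨅ z, Module.End.maxGenEigenspace (ρ z) (χ z) :=
    Module.End.independent_iInf_maxGenEigenspace_of_forall_mapsTo (fun z => (ρ z : Module.End k V))
      fun i j φ => Module.End.mapsTo_maxGenEigenspace_of_comm
        (show ρ j * ρ i = ρ i * ρ j by rw [← map_mul, ← map_mul, mul_comm]) φ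
  have hinj : Function.Injective fun (ψ : Z →* kˣ) (z : Z) => ((ψ z : kˣ) : k) := by
    intro ψ ψ' h
    ext z
    exact congr_fun h z
  exact (hind.comp hinj).mono fun ψ => wt_le_iInf_maxGenEigenspace ρ ψ

/-- a character occurring on a NON-ZERO weight vector fixed by `n` is trivial at `n`.
[cite: Liu2021, proof of Thm. 4.15 (l. 2199–2212)] -/
theorem eq_one_of_mem_weightSpace {ψ : Z →* kˣ} {w : V} (hw : w ∈ wt ρ ψ) (hw0 : w ≠ 0) {n : Z}
    (hn : ρ n w = w) : ψ n = 1 := by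
  have h : ρ n w = ((ψ n : kˣ) : k) • w := (mem_weightSpace.1 hw) n
  rw [hn] at h
  -- `w = ψ n • w`, `w ≠ 0` ⇒ `ψ n = 1`
  have h1 : (((ψ n : kˣ) : k) - 1) • w = 0 := by rw [sub_smul, one_smul, ← h, sub_self]
  rcases smul_eq_zero.1 h1 with h2 | h2
  · exact Units.val_eq_one.1 (sub_eq_zero.1 h2)
  · exact absurd h2 hw0


/-- cancellation of a non-zero vector: `a • x = b • x`, `x ≠ 0` ⇒ `a = b` (private plumbing). [folklore] -/
private theorem smul_cancel_of_ne_zero {a b : k} {x : V} (hx : x ≠ 0) (h : a • x = b • x) : a = b := by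
  have h1 : (a - b) • x = 0 := by rw [sub_smul, h, sub_self]
  rcases smul_eq_zero.1 h1 with h2 | h2
  · exact sub_eq_zero.1 h2
  · exact absurd h2 hx

/-! ## The weight spaces span

Engine: for `v ∈ V` fixed by the finite-index subgroup `N`, the `k`-span `W` of the orbit `ρ(Z) v` is `Z`-stable,
finite-dimensional (the orbit factors through the finite quotient `Z ⧸ N`) and killed by `N`; so on `W` every `ρ z`
satisfies `X ^ [Z : N] − 1`, squarefree in characteristic `0`, hence is SEMISIMPLE (Mathlib
`Module.End.isSemisimple_of_squarefree_aeval_eq_zero`), its maximal generalised eigenspaces are eigenspaces, and the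
commuting family `(ρ z)|_W`, `z : Z`, has simultaneous eigenspaces spanning `W` (Mathlib
`Module.End.iSup_iInf_maxGenEigenspace_eq_top_of_iSup_maxGenEigenspace_eq_top_of_commute`); a NON-ZERO simultaneous
eigenvector defines a character `Z →* kˣ`. -/

section Span

/-- the orbit of a vector fixed by a finite-index subgroup is finite. [cite: GelbartRogawski1991, §3.1 p. 454] -/
theorem finite_range_apply_of_fixed (v : V) (N : Subgroup Z) [N.FiniteIndex] (hN : ∀ n ∈ N, ρ n v = v) :
    (Set.range fun z : Z => ρ z v).Finite := by
  classical
  refine (Set.finite_range fun q : Z ⧸ N => ρ q.out v).subset ?_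
  rintro _ ⟨z, rfl⟩
  obtain ⟨n, hn⟩ := QuotientGroup.mk_out_eq_mul N z
  refine ⟨(z : Z ⧸ N), ?_⟩
  dsimp only
  rw [hn, map_mul, Module.End.mul_apply, hN n n.2]

/-- the `k`-span of the `Z`-orbit of `v`, as a sub-`Z`-representation (private plumbing: the restricted action).
[folklore] -/
private def orbitRep (v : V) :
    Representation k Z (Submodule.span k (Set.range fun z : Z => ρ z v)) where
  toFun z := (ρ z).restrict (p := Submodule.span k (Set.range fun z : Z => ρ z v))
      (q := Submodule.span k (Set.range fun z : Z => ρ z v)) fun w hw => by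
    refine Submodule.span_induction ?_ ?_ ?_ ?_ hw
    · rintro _ ⟨z', rfl⟩
      exact Submodule.subset_span ⟨z * z', show ρ (z * z') v = ρ z (ρ z' v) by
        rw [map_mul, Module.End.mul_apply]⟩
    · rw [map_zero]; exact Submodule.zero_mem _
    · intro x y _ _ hx hy; rw [map_add]; exact Submodule.add_mem _ hx hy
    · intro a x _ hx; rw [map_smul]; exact Submodule.smul_mem _ a hx
  map_one' := by
    refine LinearMap.ext fun w => Subtype.ext ?_
    rw [LinearMap.restrict_apply]
    simp only [map_one, Module.End.one_apply]
  map_mul' z z' := by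
    refine LinearMap.ext fun w => Subtype.ext ?_
    simp only [LinearMap.restrict_apply, map_mul, Module.End.mul_apply]

/-- value of the restricted action on the underlying vectors (private plumbing). [folklore] -/
private theorem coe_orbitRep_apply (v : V) (z : Z) (w : Submodule.span k (Set.range fun z : Z => ρ z v)) :
    ((orbitRep ρ v z w : Submodule.span k (Set.range fun z : Z => ρ z v)) : V) = ρ z (w : V) := rfl

variable [IsAlgClosed k] [CharZero k]

/-- (pointwise) : a vector fixed by a finite-index subgroup of the commutative group `Z` lies in the sum of
the weight spaces (`k` algebraically closed of characteristic zero).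
[cite: Liu2021, proof of Thm. 4.15 (l. 2199–2212); GelbartRogawski1991, §3.1 p. 454] -/
theorem mem_iSup_weightSpace_of_fixed (v : V) (N : Subgroup Z) [N.FiniteIndex] (hN : ∀ n ∈ N, ρ n v = v) :
    v ∈ ⨆ ψ : Z →* kˣ, wt ρ ψ := by
  classical
  set W : Submodule k V := Submodule.span k (Set.range fun z : Z => ρ z v) with hWdef
  have hvW : v ∈ W := Submodule.subset_span ⟨1, show ρ 1 v = v by rw [map_one, Module.End.one_apply]⟩
  -- `N` acts trivially on `W`
  have hNW : ∀ n ∈ N, ∀ w ∈ W, ρ n w = w := by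
    intro n hn w hw
    refine Submodule.span_induction ?_ ?_ ?_ ?_ hw
    · rintro _ ⟨z', rfl⟩
      rw [← Module.End.mul_apply, ← map_mul, mul_comm, map_mul, Module.End.mul_apply, hN n hn]
    · rw [map_zero]
    · intro x y _ _ hx hy; rw [map_add, hx, hy]
    · intro a x _ hx; rw [map_smul, hx]
  haveI : FiniteDimensional k W := FiniteDimensional.span_of_finite k (finite_range_apply_of_fixed ρ v N hN)
  -- the restricted commuting family
  let σ : Representation k Z W := orbitRep ρ v
  have hσcomm : Pairwise fun i j => Commute (σ i) (σ j) := fun i j _ =>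
    show σ i * σ j = σ j * σ i by rw [← map_mul, ← map_mul, mul_comm]
  -- every `σ z` is killed by `X ^ [Z:N] − 1`, squarefree: semisimple
  have hm0 : (N.index : k) ≠ 0 := by exact_mod_cast (Subgroup.index_ne_zero_of_finite : N.index ≠ 0)
  have hsq : Squarefree (Polynomial.X ^ N.index - Polynomial.C (1 : k)) :=
    (Polynomial.separable_X_pow_sub_C (1 : k) hm0 one_ne_zero).squarefree
  have hpow : ∀ z : Z, σ z ^ N.index = 1 := by
    intro z
    rw [← map_pow]
    refine LinearMap.ext fun w => Subtype.ext ?_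
    rw [Module.End.one_apply]
    exact hNW _ (N.pow_index_mem z) (w : V) w.2
  have hss : ∀ z : Z, Module.End.IsSemisimple (σ z) := fun z =>
    Module.End.isSemisimple_of_squarefree_aeval_eq_zero hsq (by
      rw [map_sub, map_pow, Polynomial.aeval_X, Polynomial.aeval_C, map_one, hpow z, sub_self])
  -- simultaneous eigenspaces span `W`
  have hgen : ∀ z : Z, ⨆ μ : k, Module.End.maxGenEigenspace (σ z) μ = ⊤ := fun z =>
    Module.End.iSup_maxGenEigenspace_eq_top _
  have htop : ⨆ χ : Z → k, ⨅ z, Module.End.maxGenEigenspace (σ z) (χ z) = ⊤ :=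
    Module.End.iSup_iInf_maxGenEigenspace_eq_top_of_iSup_maxGenEigenspace_eq_top_of_commute
      (fun z => (σ z : Module.End k W)) hσcomm hgen
  have hEq : ∀ (z : Z) (μ : k), Module.End.maxGenEigenspace (σ z) μ = Module.End.eigenspace (σ z) μ := fun z μ =>
    (Module.End.isFinitelySemisimple_iff_isSemisimple.mpr (hss z)).maxGenEigenspace_eq_eigenspace μ
  simp_rw [hEq] at htop
  -- read a simultaneous eigenvector back in `V`
  have hmem : (⟨v, hvW⟩ : W) ∈ ⨆ χ : Z → k, ⨅ z, Module.End.eigenspace (σ z) (χ z) := by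
    rw [htop]; exact Submodule.mem_top
  suffices key : ∀ x : W, x ∈ (⨆ χ : Z → k, ⨅ z, Module.End.eigenspace (σ z) (χ z)) →
      (x : V) ∈ ⨆ ψ : Z →* kˣ, wt ρ ψ from key ⟨v, hvW⟩ hmem
  intro x hx
  refine Submodule.iSup_induction (fun χ : Z → k => ⨅ z, Module.End.eigenspace (σ z) (χ z))
    (motive := fun x : W => (x : V) ∈ ⨆ ψ : Z →* kˣ, wt ρ ψ) hx ?_ ?_ ?_
  · intro χ x hxχ
    have hev : ∀ z : Z, ρ z (x : V) = χ z • (x : V) := fun z => by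
      have h1 := Module.End.mem_eigenspace_iff.1 ((Submodule.mem_iInf _).1 hxχ z)
      have h2 := congrArg Subtype.val h1
      rwa [Submodule.coe_smul] at h2
    by_cases hx0 : (x : V) = 0
    · rw [hx0]; exact Submodule.zero_mem _
    -- `χ` is a character on the support of `x`
    have hχ0 : ∀ z : Z, χ z ≠ 0 := fun z hz => by
      have h1 : ρ z (x : V) = 0 := by rw [hev z, hz, zero_smul]
      apply hx0
      have h2 := congrArg (ρ z⁻¹) h1
      rwa [← Module.End.mul_apply, ← map_mul, inv_mul_cancel, map_one, Module.End.one_apply, map_zero] at h2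
    let ψ : Z →* kˣ :=
      { toFun := fun z => Units.mk0 (χ z) (hχ0 z)
        map_one' := by
          refine Units.ext ?_
          rw [Units.val_mk0, Units.val_one]
          refine smul_cancel_of_ne_zero hx0 ?_
          rw [← hev 1, map_one, Module.End.one_apply, one_smul]
        map_mul' := fun a b => by
          refine Units.ext ?_
          rw [Units.val_mk0, Units.val_mul, Units.val_mk0, Units.val_mk0]
          refine smul_cancel_of_ne_zero hx0 ?_
          rw [← hev (a * b), map_mul, Module.End.mul_apply, hev b, map_smul, hev a, smul_smul, mul_comm] }
    have hxψ : (x : V) ∈ wt ρ ψ := mem_weightSpace.2 fun z => hev z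
    exact Submodule.mem_iSup_of_mem ψ hxψ
  · exact Submodule.zero_mem _
  · intro x y hx hy
    rw [Submodule.coe_add]
    exact Submodule.add_mem _ hx hy

/-- for `k` algebraically closed of characteristic `0` and a representation of a COMMUTATIVE group in which
every vector is fixed by some finite-index subgroup, the weight spaces SPAN: `⨆ ψ, wt ψ = ⊤`.
[cite: Liu2021, proof of Thm. 4.15 (l. 2199–2212); GelbartRogawski1991, §3.1 p. 454] -/
theorem iSup_weightSpace_eq_top (h : ∀ v : V, ∃ N : Subgroup Z, N.FiniteIndex ∧ ∀ n ∈ N, ρ n v = v) :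
    ⨆ ψ : Z →* kˣ, wt ρ ψ = ⊤ := by
  refine Submodule.eq_top_iff'.2 fun v => ?_
  obtain ⟨N, hNfi, hN⟩ := h v
  exact mem_iSup_weightSpace_of_fixed ρ v N hN

end Span


/-- an endomorphism commuting with `ρ(Z)` preserves every weight space. [cite: GelbartRogawski1991, §3.1 p. 454] -/
theorem map_mem_wt_of_commute (f : V →ₗ[k] V) (hf : ∀ z : Z, Commute f (ρ z)) {ψ : Z →* kˣ} {v : V}
    (hv : v ∈ wt ρ ψ) : f v ∈ wt ρ ψ := by
  rw [mem_weightSpace] at hv ⊢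
  intro z
  have hc := LinearMap.congr_fun (hf z).eq v
  simp only [Module.End.mul_apply] at hc
  change ρ z (f v) = _
  rw [← hc]
  change f (ρ (id z) v) = _
  rw [hv z, map_smul]


/-! ## The internal direct sum and its projections -/

section Proj

variable [DecidableEq (Z →* kˣ)] [IsAlgClosed k] [CharZero k]

/-- `V = ⨁ ψ, wt ψ` (internal direct sum), for `k` algebraically closed of characteristic `0` and a
representation of a commutative group with finite-index stabilisers.
[cite: Liu2021, proof of Thm. 4.15 (l. 2199–2212); GelbartRogawski1991, §3.1 p. 454] -/
theorem isInternal_weightSpace (h : ∀ v : V, ∃ N : Subgroup Z, N.FiniteIndex ∧ ∀ n ∈ N, ρ n v = v) :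
    DirectSum.IsInternal fun ψ : Z →* kˣ => wt ρ ψ :=
  DirectSum.isInternal_submodule_of_iSupIndep_of_iSup_eq_top (iSupIndep_weightSpace ρ)
    (iSup_weightSpace_eq_top ρ h)

/-- the decomposition isomorphism `V ≃ ⨁ ψ, wt ψ` (inverse of the sum map; private plumbing). [folklore] -/
private def decomp (h : ∀ v : V, ∃ N : Subgroup Z, N.FiniteIndex ∧ ∀ n ∈ N, ρ n v = v) :
    V ≃ₗ[k] ⨁ ψ : Z →* kˣ, wt ρ ψ :=
  (LinearEquiv.ofBijective (DirectSum.coeLinearMap fun ψ : Z →* kˣ => wt ρ ψ) (isInternal_weightSpace ρ h)).symm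

/-- **The weight projection** `V → wt ψ ↪ V` of the decomposition `V = ⨁ ψ, wt ψ`.
[cite: Liu2021, proof of Thm. 4.15 (l. 2199–2212)] -/
def weightProj (h : ∀ v : V, ∃ N : Subgroup Z, N.FiniteIndex ∧ ∀ n ∈ N, ρ n v = v) (ψ : Z →* kˣ) :
    V →ₗ[k] V :=
  (wt ρ ψ).subtype ∘ₗ DirectSum.component k (Z →* kˣ) (fun ψ => wt ρ ψ) ψ ∘ₗ (decomp ρ h).toLinearMap

variable (h : ∀ v : V, ∃ N : Subgroup Z, N.FiniteIndex ∧ ∀ n ∈ N, ρ n v = v)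

/-- unfolding: `weightProj ψ v` is the `ψ`-component of `v` in `V = ⨁ wt`. [cite: Liu2021, proof of Thm. 4.15 (l. 2199–2212)] -/
theorem weightProj_apply (ψ : Z →* kˣ) (v : V) :
    weightProj ρ h ψ v =
      (((LinearEquiv.ofBijective (DirectSum.coeLinearMap fun ψ : Z →* kˣ => wt ρ ψ)
          (isInternal_weightSpace ρ h)).symm v) ψ : V) := rfl

/-- the projection lands in the weight space. [cite: Liu2021, proof of Thm. 4.15 (l. 2199–2212)] -/
theorem weightProj_apply_mem (ψ : Z →* kˣ) (v : V) : weightProj ρ h ψ v ∈ wt ρ ψ := by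
  rw [weightProj_apply]; exact Submodule.coe_mem _

/-- the projection is the identity on its weight space. [cite: Liu2021, proof of Thm. 4.15 (l. 2199–2212)] -/
theorem weightProj_eq_self_of_mem {ψ : Z →* kˣ} {v : V} (hv : v ∈ wt ρ ψ) : weightProj ρ h ψ v = v := by
  rw [weightProj_apply, DirectSum.IsInternal.ofBijective_coeLinearMap_of_mem _ hv]

/-- the projection kills the other weight spaces. [cite: Liu2021, proof of Thm. 4.15 (l. 2199–2212)] -/
theorem weightProj_eq_zero_of_mem_ne {φ ψ : Z →* kˣ} (hne : φ ≠ ψ) {v : V} (hv : v ∈ wt ρ φ) :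
    weightProj ρ h ψ v = 0 := by
  rw [weightProj_apply, DirectSum.IsInternal.ofBijective_coeLinearMap_of_mem_ne _ hne hv, Submodule.coe_zero]

/-- idempotence and orthogonality of the projections. [cite: Liu2021, proof of Thm. 4.15 (l. 2199–2212)] -/
theorem weightProj_weightProj (φ ψ : Z →* kˣ) (v : V) :
    weightProj ρ h ψ (weightProj ρ h φ v) = if φ = ψ then weightProj ρ h ψ v else 0 := by
  split_ifs with hφψ
  · subst hφψ; exact weightProj_eq_self_of_mem ρ h (weightProj_apply_mem ρ h φ v)
  · exact weightProj_eq_zero_of_mem_ne ρ h hφψ (weightProj_apply_mem ρ h φ v)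

/-- **finite support and reconstruction**: `v` is the (finite) sum of its weight components.
[cite: Liu2021, proof of Thm. 4.15 (l. 2199–2212)] -/
theorem exists_finset_sum_weightProj (v : V) :
    ∃ s : Finset (Z →* kˣ), (∀ ψ, ψ ∉ s → weightProj ρ h ψ v = 0) ∧ ∑ ψ ∈ s, weightProj ρ h ψ v = v := by
  classical
  set e := LinearEquiv.ofBijective (DirectSum.coeLinearMap fun ψ : Z →* kˣ => wt ρ ψ) (isInternal_weightSpace ρ h)
    with he
  refine ⟨DFinsupp.support (e.symm v), fun ψ hψ => ?_, ?_⟩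
  · rw [weightProj_apply, ← he, DFinsupp.notMem_support_iff.1 hψ, Submodule.coe_zero]
  · have hsum : DirectSum.coeLinearMap (fun ψ : Z →* kˣ => wt ρ ψ) (e.symm v) = v :=
      e.apply_symm_apply v
    conv_rhs => rw [← hsum, DirectSum.coeLinearMap_eq_dfinsuppSum]
    rw [DFinsupp.sum]
    refine Finset.sum_congr rfl fun ψ _ => ?_
    rw [weightProj_apply, ← he]

/-- **`weightProj_comm`**: an endomorphism commuting with `ρ(Z)` COMMUTES WITH THE WEIGHT PROJECTIONS.
[cite: Liu2021, proof of Thm. 4.15 (l. 2199–2212); GelbartRogawski1991, §3.1 p. 454] -/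
theorem weightProj_comm (f : V →ₗ[k] V) (hf : ∀ z : Z, Commute f (ρ z)) (ψ : Z →* kˣ) (v : V) :
    weightProj ρ h ψ (f v) = f (weightProj ρ h ψ v) := by
  have hv : v ∈ ⨆ φ : Z →* kˣ, wt ρ φ := by rw [iSup_weightSpace_eq_top ρ h]; exact Submodule.mem_top
  refine Submodule.iSup_induction (fun φ : Z →* kˣ => wt ρ φ)
    (motive := fun v => weightProj ρ h ψ (f v) = f (weightProj ρ h ψ v)) hv ?_ ?_ ?_
  · intro φ v hvφ
    by_cases hφψ : φ = ψ
    · subst hφψ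
      rw [weightProj_eq_self_of_mem ρ h hvφ, weightProj_eq_self_of_mem ρ h (map_mem_wt_of_commute ρ f hf hvφ)]
    · rw [weightProj_eq_zero_of_mem_ne ρ h hφψ hvφ,
        weightProj_eq_zero_of_mem_ne ρ h hφψ (map_mem_wt_of_commute ρ f hf hvφ), map_zero]
  · rw [map_zero, map_zero, map_zero]
  · intro x y hx hy
    rw [map_add, map_add, map_add, map_add, hx, hy]

/-- in particular the operators `ρ z` themselves commute with the projections. [cite: GelbartRogawski1991, §3.1 p. 454] -/
theorem weightProj_comm_apply (z : Z) (ψ : Z →* kˣ) (v : V) :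
    weightProj ρ h ψ (ρ z v) = ρ z (weightProj ρ h ψ v) :=
  weightProj_comm ρ h (ρ z) (fun z' => show ρ z * ρ z' = ρ z' * ρ z by rw [← map_mul, ← map_mul, mul_comm]) ψ v

/-- the projection onto `wt ψ` acts on its image through `ψ`: `ρ z (weightProj ψ v) = ψ z • weightProj ψ v`.
[cite: Liu2021, proof of Thm. 4.15 (l. 2199–2212)] -/
theorem apply_weightProj (z : Z) (ψ : Z →* kˣ) (v : V) :
    ρ z (weightProj ρ h ψ v) = ((ψ z : kˣ) : k) • weightProj ρ h ψ v :=
  (mem_weightSpace.1 (weightProj_apply_mem ρ h ψ v)) z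

end Proj

end Literature.RepresentationTheory

end
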